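import Mathlib
import Summits.ValiantsHypothesis.ValiantsHypothesis.Theses.GirthSidon
import Summits.ValiantsHypothesis.ValiantsHypothesis.Theorems.GirthSidonMomentCurveElusiveEchelon

/-!
# GirthSidon — the Hilbert-function regime of the formal cancellation crux
(helper lemmas for the crux `MomentCurveElusive`, item `stmt-ValiantsHypothesis-6534`,
line `registered` / `Lines/birth.lean`; they serve the registered stubs
`stub_swallowedInSmallSumset` (cover form) and `stub_formalSwallowForcesShortRelation`
(relation form = route item 6536 verbatim) without closing either)

Setting: a finite-dimensional subspace `V ⊂ K((t))` and distinct monomials `t^{D_i} ∈ V · V`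
(`i < m`).  If the exponents `D_i` carry no additive relation of length `≤ h`
(distinct multisets of at most `h` indices have distinct `D`-sums), then the `C(m+h-1, h)`
monomials `t^{D_{i_1} + ⋯ + D_{i_h}}` are pairwise distinct, hence linearly independent, and all
of them lie in the span of `2h`-fold products of elements of `V`, a space of dimension at most
`C(finrank V + 2h - 1, 2h)` (products of multisets of basis vectors).  Hence

  `C(m + h - 1, h) ≤ C(finrank V + 2h - 1, 2h)`            (`choose_le_choose_of_noRelation`),

which is the dimension count of Narayanan 2026 (§2, proof of Thm. 1) run INSIDE the source space
`V` instead of inside `ℂ[z_1, …, z_s]`: in the tree's vocabulary it says that a formal quadratic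
swallowing `Γ_i(y) = t^{D_i}` (`y ∈ K((t))^s`, `V = span(1, y)`, `finrank V ≤ s + 1`) forces a
relation `Σ_S D = Σ_T D`, `S ≠ T`, `|S|, |T| ≤ 30`, as soon as

  `C(s + 60, 60) < C(m + 29, 30)`,   i.e. roughly `s + 60 < 6.67 · √m`

(`exists_relation_of_choose_lt`, the conclusion of item 6536 / `stub_formalSwallowForcesShortRelation`
under this extra hypothesis).  This is the exact extent of the "Hilbert-function" technique on the
leaf (strategy census `Cruxes/MomentCurveElusive/STRATEGY-CENSUS.md`, §Transfer T1): it improves the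
trivial regime `C(s+2, 2) < m` (distinct monomials in `V·V` are independent) by a constant factor
`≈ 4.7` in `s`, and no further — the crux asks for `s ≤ m^{0.9}`.
-/

-- `Summit.ValiantsHypothesis.ValiantsHypothesis.…` is the tree's mandated single-conjunct layout
-- (Sub = Summit), so the duplicated namespace component is intended.
set_option linter.dupNamespace false

namespace Summit.ValiantsHypothesis.ValiantsHypothesis.Theorems

open scoped Pointwise

section ProdSpan

variable {K : Type*} [Field K]

/-! The `k`-fold products of elements of `V` are written
`Set.range (fun v : Fin k → V => ∏ j, (v j : K((t))))` throughout (no auxiliary definition). -/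

/-- Membership of an explicit product of elements of `V` in the set of `k`-fold products.
[folklore] -/
theorem prod_mem_range_prod (V : Submodule K (LaurentSeries K)) {k : ℕ}
    (v : Fin k → LaurentSeries K) (hv : ∀ j, v j ∈ V) :
    (∏ j, v j) ∈ Set.range (fun v : Fin k → V => ∏ j, (v j : LaurentSeries K)) :=
  ⟨fun j => ⟨v j, hv j⟩, rfl⟩

/-- The product of an `a`-fold and a `b`-fold product of elements of `V` is an `(a + b)`-fold
product (concatenate the two families). [folklore] -/
theorem mul_mem_range_prod (V : Submodule K (LaurentSeries K)) {a b : ℕ} {x y : LaurentSeries K}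
    (hx : x ∈ Set.range (fun v : Fin a → V => ∏ j, (v j : LaurentSeries K)))
    (hy : y ∈ Set.range (fun v : Fin b → V => ∏ j, (v j : LaurentSeries K))) :
    x * y ∈ Set.range (fun v : Fin (a + b) → V => ∏ j, (v j : LaurentSeries K)) := by
  obtain ⟨v, rfl⟩ := hx
  obtain ⟨w, rfl⟩ := hy
  refine ⟨Fin.append v w, ?_⟩
  simp only [Fin.prod_univ_add, Fin.append_left, Fin.append_right]

/-- The spans of products are multiplicative: (span of `a`-fold products) · (span of `b`-fold
products) `⊆` span of `(a + b)`-fold products. [folklore] -/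
theorem mul_mem_span_range_prod (V : Submodule K (LaurentSeries K)) {a b : ℕ}
    {x y : LaurentSeries K}
    (hx : x ∈ Submodule.span K (Set.range (fun v : Fin a → V => ∏ j, (v j : LaurentSeries K))))
    (hy : y ∈ Submodule.span K (Set.range (fun v : Fin b → V => ∏ j, (v j : LaurentSeries K)))) :
    x * y ∈ Submodule.span K
      (Set.range (fun v : Fin (a + b) → V => ∏ j, (v j : LaurentSeries K))) := by
  induction hx using Submodule.span_induction generalizing y with
  | mem x hx =>
    induction hy using Submodule.span_induction with
    | mem y hy => exact Submodule.subset_span (mul_mem_range_prod V hx hy)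
    | zero => simp
    | add y z _ _ ihy ihz => rw [mul_add]; exact Submodule.add_mem _ ihy ihz
    | smul c y _ ih =>
      rw [← HahnSeries.C_mul_eq_smul, mul_left_comm, HahnSeries.C_mul_eq_smul]
      exact Submodule.smul_mem _ _ ih
  | zero => simp
  | add x z _ _ ihx ihz => rw [add_mul]; exact Submodule.add_mem _ (ihx hy) (ihz hy)
  | smul c x _ ih =>
    rw [← HahnSeries.C_mul_eq_smul, mul_assoc, HahnSeries.C_mul_eq_smul]
    exact Submodule.smul_mem _ _ (ih hy)

/-- `span (↑V * ↑V)` (the tree's spelling of `V · V`) lies in the span of `2`-fold products.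
[folklore] -/
theorem span_mul_le_span_range_prod_two (V : Submodule K (LaurentSeries K)) :
    Submodule.span K ((V : Set (LaurentSeries K)) * (V : Set (LaurentSeries K))) ≤
      Submodule.span K (Set.range (fun v : Fin 2 → V => ∏ j, (v j : LaurentSeries K))) := by
  rw [Submodule.span_le]
  rintro _ ⟨v, hv, w, hw, rfl⟩
  refine Submodule.subset_span ⟨![⟨v, hv⟩, ⟨w, hw⟩], ?_⟩
  simp [Fin.prod_univ_two]

/-- A product of `h` elements of `V · V` lies in the span of `2h`-fold products of elements of
`V`. [folklore] -/
theorem multiset_prod_mem_span_range_prod (V : Submodule K (LaurentSeries K))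
    (T : Multiset (LaurentSeries K))
    (hT : ∀ x ∈ T, x ∈ Submodule.span K ((V : Set (LaurentSeries K)) * (V : Set (LaurentSeries K)))) :
    T.prod ∈ Submodule.span K
      (Set.range (fun v : Fin (2 * Multiset.card T) → V => ∏ j, (v j : LaurentSeries K))) := by
  induction T using Multiset.induction_on with
  | empty =>
    simp only [Multiset.prod_zero, Multiset.card_zero]
    exact Submodule.subset_span ⟨Fin.elim0, by simp⟩
  | cons a T ih =>
    rw [Multiset.prod_cons, Multiset.card_cons]
    have ha := span_mul_le_span_range_prod_two V (hT a (Multiset.mem_cons_self a T))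
    have hT' := ih fun x hx => hT x (Multiset.mem_cons_of_mem hx)
    have h2 : 2 * (Multiset.card T + 1) = 2 + 2 * Multiset.card T := by ring
    rw [h2]
    exact mul_mem_span_range_prod V ha hT'

/-- **Products of multisets of basis vectors span all `k`-fold products.** For a
finite-dimensional `V ⊂ K((t))` there is a finite set of at most `C(finrank V + k - 1, k)` series
(the products of the multisets of `k` vectors of a basis) whose span contains every `k`-fold
product of elements of `V` (expand each factor in the basis). [folklore] -/
theorem exists_finset_range_prod_subset_span (V : Submodule K (LaurentSeries K))
    [FiniteDimensional K V] (k : ℕ) :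
    ∃ F : Finset (LaurentSeries K), F.card ≤ (Module.finrank K V + k - 1).choose k ∧
      Set.range (fun v : Fin k → V => ∏ j, (v j : LaurentSeries K)) ⊆
        (Submodule.span K (F : Set (LaurentSeries K)) : Set (LaurentSeries K)) := by
  classical
  set n := Module.finrank K V
  let b := Module.finBasis K V
  -- the products of multisets of basis vectors
  let M : Sym (Fin n) k → LaurentSeries K := fun s => (s.1.map fun i => (b i : LaurentSeries K)).prod
  refine ⟨Finset.univ.image M, ?_, ?_⟩
  · calc (Finset.univ.image M).card ≤ Fintype.card (Sym (Fin n) k) :=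
          Finset.card_image_le.trans (by simp)
      _ = (n + k - 1).choose k := by
          rw [Sym.card_sym_eq_multichoose, Nat.multichoose_eq, Fintype.card_fin]
  rintro _ ⟨v, rfl⟩
  -- expand each factor in the basis
  have hexp : ∀ j, (v j : LaurentSeries K) = ∑ i, b.repr (v j) i • (b i : LaurentSeries K) := by
    intro j
    have h := congr_arg (fun x : V => (x : LaurentSeries K)) (b.sum_repr (v j))
    simp only [Submodule.coe_sum, Submodule.coe_smul] at h
    exact h.symm
  have hprod : (∏ j, (v j : LaurentSeries K)) =
      ∏ j, ∑ i, b.repr (v j) i • (b i : LaurentSeries K) :=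
    Finset.prod_congr rfl fun j _ => hexp j
  simp only
  rw [hprod, Fintype.prod_sum]
  refine Submodule.sum_mem _ fun f _ => ?_
  -- `∏ j, c_j • b (f j) = (∏ c_j) • ∏ b (f j)` and `∏ b (f j) = M ⟦f⟧`
  have hsmul : (∏ j, b.repr (v j) (f j) • (b (f j) : LaurentSeries K)) =
      (∏ j, b.repr (v j) (f j)) • ∏ j, (b (f j) : LaurentSeries K) := by
    simp_rw [← HahnSeries.C_mul_eq_smul]
    rw [Finset.prod_mul_distrib, map_prod]
  rw [hsmul]
  refine Submodule.smul_mem _ _ (Submodule.subset_span ?_)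
  simp only [Finset.coe_image, Finset.coe_univ, Set.image_univ, Set.mem_range]
  refine ⟨⟨Finset.univ.val.map f, by simp⟩, ?_⟩
  simp only [M, Multiset.map_map, Function.comp_def, Finset.prod_eq_multiset_prod]

/-- The span of the `k`-fold products of a finite-dimensional `V ⊂ K((t))` is finite-dimensional.
[folklore] -/
theorem finiteDimensional_span_range_prod (V : Submodule K (LaurentSeries K))
    [FiniteDimensional K V] (k : ℕ) :
    FiniteDimensional K
      (Submodule.span K (Set.range (fun v : Fin k → V => ∏ j, (v j : LaurentSeries K)))) := by
  obtain ⟨F, _, hF⟩ := exists_finset_range_prod_subset_span V k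
  haveI : FiniteDimensional K (Submodule.span K (F : Set (LaurentSeries K))) :=
    FiniteDimensional.span_of_finite K F.finite_toSet
  exact Submodule.finiteDimensional_of_le (Submodule.span_le.2 hF)

/-- **Dimension of the span of `k`-fold products.** For a finite-dimensional `V ⊂ K((t))`, the
`k`-fold products of elements of `V` span a space of dimension at most
`C(finrank V + k - 1, k)`. [folklore] -/
theorem finrank_span_range_prod_le (V : Submodule K (LaurentSeries K)) [FiniteDimensional K V]
    (k : ℕ) :
    Module.finrank K
        (Submodule.span K (Set.range (fun v : Fin k → V => ∏ j, (v j : LaurentSeries K)))) ≤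
      (Module.finrank K V + k - 1).choose k := by
  obtain ⟨F, hcard, hF⟩ := exists_finset_range_prod_subset_span V k
  haveI : FiniteDimensional K (Submodule.span K (F : Set (LaurentSeries K))) :=
    FiniteDimensional.span_of_finite K F.finite_toSet
  calc Module.finrank K
        (Submodule.span K (Set.range (fun v : Fin k → V => ∏ j, (v j : LaurentSeries K))))
      ≤ Module.finrank K (Submodule.span K (F : Set (LaurentSeries K))) :=
        Submodule.finrank_mono (Submodule.span_le.2 hF)
    _ ≤ F.card := finrank_span_finset_le_card F
    _ ≤ (Module.finrank K V + k - 1).choose k := hcard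

end ProdSpan

section HilbertCount

variable {K : Type*} [Field K]

/-- A product of monomials `t^{e_i}` over a multiset is the monomial `t^{Σ e_i}`. [folklore] -/
theorem multiset_prod_map_single_one (S : Multiset ℤ) :
    (S.map fun e => HahnSeries.single e (1 : K)).prod =
      (HahnSeries.single S.sum (1 : K) : LaurentSeries K) := by
  induction S using Multiset.induction_on with
  | empty => simp
  | cons a S ih =>
    rw [Multiset.map_cons, Multiset.prod_cons, ih, Multiset.sum_cons, HahnSeries.single_mul_single,
      mul_one]

/-- **The Hilbert-function count inside the source space.** Let `V ⊂ K((t))` be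
finite-dimensional and let `t^{D_i} ∈ V · V` (`i < m`) be monomials whose exponents admit no
additive relation of length `≤ h` (distinct multisets of at most `h` indices have distinct
`D`-sums).  Then `C(m + h - 1, h) ≤ C(finrank V + 2h - 1, 2h)`: the `h`-fold products of the
`t^{D_i}` are `C(m+h-1, h)` distinct monomials, hence linearly independent, inside the span of the
`2h`-fold products of elements of `V`.  (Narayanan 2026, §2, dimension count — transported from
`ℂ[z_1,…,z_s]_{≤ 2ℓ}` to `V^{2h} ⊂ K((t))`.) [cite: Narayanan2026, §2 (proof of Thm. 1)] -/
theorem choose_le_choose_of_noRelation (V : Submodule K (LaurentSeries K)) [FiniteDimensional K V]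
    {m : ℕ} (D : Fin m → ℤ) (h : ℕ)
    (hmem : ∀ i, HahnSeries.single (D i) (1 : K) ∈
      Submodule.span K ((V : Set (LaurentSeries K)) * (V : Set (LaurentSeries K))))
    (hfree : ∀ S T : Multiset (Fin m), Multiset.card S ≤ h → Multiset.card T ≤ h →
      (S.map D).sum = (T.map D).sum → S = T) :
    (m + h - 1).choose h ≤ (Module.finrank K V + 2 * h - 1).choose (2 * h) := by
  classical
  set W := Submodule.span K (Set.range (fun v : Fin (2 * h) → V => ∏ j, (v j : LaurentSeries K)))
    with hW
  haveI : FiniteDimensional K W := finiteDimensional_span_range_prod V (2 * h)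
  -- the `h`-fold products of the monomials
  let F : Sym (Fin m) h → LaurentSeries K :=
    fun S => HahnSeries.single (((S : Multiset (Fin m)).map D).sum) (1 : K)
  have hFmem : ∀ S, F S ∈ W := by
    intro S
    have hprod := multiset_prod_mem_span_range_prod V
      ((S : Multiset (Fin m)).map fun i => HahnSeries.single (D i) (1 : K))
      (by
        intro x hx
        rw [Multiset.mem_map] at hx
        obtain ⟨i, _, rfl⟩ := hx
        exact hmem i)
    have hc : Multiset.card ((S : Multiset (Fin m)).map fun i => HahnSeries.single (D i) (1 : K)) =
        h := by simp
    rw [hc] at hprod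
    have hF : ((S : Multiset (Fin m)).map fun i => HahnSeries.single (D i) (1 : K)).prod = F S := by
      simp only [F]
      rw [← multiset_prod_map_single_one, Multiset.map_map]
      rfl
    rwa [hF] at hprod
  -- they are linearly independent (distinct orders)
  have hli : LinearIndependent K (fun S => (⟨F S, hFmem S⟩ : W)) := by
    apply LinearIndependent.of_comp W.subtype
    refine linearIndependent_of_order_injective (fun S => F S) (fun S => by simp [F]) ?_
    intro S T hST
    simp only [F, HahnSeries.order_single one_ne_zero] at hST
    have hS : Multiset.card (S : Multiset (Fin m)) ≤ h := by simp
    have hT : Multiset.card (T : Multiset (Fin m)) ≤ h := by simp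
    exact Sym.coe_injective (hfree _ _ hS hT hST)
  have hcard := hli.fintype_card_le_finrank
  rw [Sym.card_sym_eq_multichoose, Nat.multichoose_eq, Fintype.card_fin] at hcard
  exact hcard.trans (finrank_span_range_prod_le V (2 * h))

/-- **The Hilbert-function regime of the formal cancellation crux** (conclusion of route item
`stmt-ValiantsHypothesis-6536` = registered stub `stub_formalSwallowForcesShortRelation`, under the
extra hypothesis `C(s + 60, 60) < C(m + 29, 30)`, i.e. roughly `s + 60 < 6.67 √m`).  If a quadratic
map `Γ : K^s → K^m` swallows the monomial vector `(t^{d_i})_i` formally along Laurent series,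
`Γ_i(y) = t^{d_i}`, and `C(s+60,60) < C(m+29,30)`, then some two distinct multisets of at most `30`
indices have equal `d`-sums.  Proof: otherwise `choose_le_choose_of_noRelation` with `h = 30` and
`V = span(1, y_1, …, y_s)` (`finrank V ≤ s + 1`) gives `C(m+29,30) ≤ C(s+60,60)`.
[cite: Narayanan2026, §2 (proof of Thm. 1)] -/
theorem exists_relation_of_choose_lt {s m : ℕ} (y : Fin s → LaurentSeries K) (d : Fin m → ℕ)
    (Γ : Fin m → MvPolynomial (Fin s) K) (hΓ : ∀ i, (Γ i).totalDegree ≤ 2)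
    (hy : ∀ i, MvPolynomial.aeval y (Γ i) = HahnSeries.single (d i : ℤ) (1 : K))
    (hlt : (s + 60).choose 60 < (m + 29).choose 30) :
    ∃ S T : Multiset (Fin m), S ≠ T ∧ Multiset.card S ≤ 30 ∧ Multiset.card T ≤ 30 ∧
      (S.map d).sum = (T.map d).sum := by
  classical
  by_contra hno
  push Not at hno
  -- the source space `V = span(1, y)` has `finrank ≤ s + 1`
  set g : Option (Fin s) → LaurentSeries K := fun o => o.elim 1 y with hg
  have hrange : Set.range g = insert 1 (Set.range y) := by
    ext x
    simp only [hg, Set.mem_range, Set.mem_insert_iff]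
    constructor
    · rintro ⟨o, rfl⟩
      cases o with
      | none => exact Or.inl rfl
      | some j => exact Or.inr ⟨j, rfl⟩
    · rintro (rfl | ⟨j, rfl⟩)
      · exact ⟨none, rfl⟩
      · exact ⟨some j, rfl⟩
  set V := Submodule.span K (insert 1 (Set.range y)) with hV
  haveI : FiniteDimensional K V := by
    rw [hV, ← hrange]; exact FiniteDimensional.span_of_finite K (Set.finite_range g)
  have hfin : Module.finrank K V ≤ s + 1 := by
    have h := finrank_range_le_card (R := K) g
    rw [hrange] at h
    simpa [Set.finrank] using h
  have h1 : (1 : LaurentSeries K) ∈ V := Submodule.subset_span (Set.mem_insert _ _)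
  have hyV : ∀ j, y j ∈ V := fun j => Submodule.subset_span (Set.mem_insert_of_mem _ ⟨j, rfl⟩)
  have hmem : ∀ i, HahnSeries.single ((fun i => (d i : ℤ)) i) (1 : K) ∈
      Submodule.span K ((V : Set (LaurentSeries K)) * (V : Set (LaurentSeries K))) := by
    intro i
    rw [← hy i]
    exact aeval_mem_mul_self_of_totalDegree_le_two y V h1 hyV (Γ i) (hΓ i)
  -- no relation of length `≤ 30` among the `d i` (cast to `ℤ`)
  have hfree : ∀ S T : Multiset (Fin m), Multiset.card S ≤ 30 → Multiset.card T ≤ 30 →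
      (S.map fun i => (d i : ℤ)).sum = (T.map fun i => (d i : ℤ)).sum → S = T := by
    intro S T hS hT hsum
    by_contra hne
    refine hno S T hne hS hT ?_
    have hS' : (S.map fun i => (d i : ℤ)).sum = ((S.map d).sum : ℕ) := by
      rw [Nat.cast_multiset_sum, Multiset.map_map]; rfl
    have hT' : (T.map fun i => (d i : ℤ)).sum = ((T.map d).sum : ℕ) := by
      rw [Nat.cast_multiset_sum, Multiset.map_map]; rfl
    rw [hS', hT'] at hsum
    exact_mod_cast hsum
  have hcount := choose_le_choose_of_noRelation V (fun i => (d i : ℤ)) 30 hmem hfree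
  have hmono : (Module.finrank K V + 2 * 30 - 1).choose (2 * 30) ≤ (s + 60).choose 60 := by
    have : Module.finrank K V + 2 * 30 - 1 ≤ s + 60 := by omega
    exact Nat.choose_le_choose _ this
  have h29 : m + 30 - 1 = m + 29 := by omega
  rw [h29] at hcount
  omega

/-- **Hilbert-function count, registered helper form** (sub-goal `helper_prodSpanCount` of item
`stmt-ValiantsHypothesis-6534`): relation-free monomials `t^{D_i} ∈ V · V`, `i < m`, force
`C(m + h - 1, h) ≤ C(finrank V + 2h - 1, 2h)`. [cite: Narayanan2026, §2 (proof of Thm. 1)] -/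
theorem helper_prodSpanCount : ∀ (V : Submodule ℂ (LaurentSeries ℂ)) [FiniteDimensional ℂ V] (m : ℕ) (D : Fin m → ℤ) (h : ℕ), (∀ i, HahnSeries.single (D i) (1 : ℂ) ∈ Submodule.span ℂ ((V : Set (LaurentSeries ℂ)) * (V : Set (LaurentSeries ℂ)))) → (∀ S T : Multiset (Fin m), Multiset.card S ≤ h → Multiset.card T ≤ h → (S.map D).sum = (T.map D).sum → S = T) → Nat.choose (m + h - 1) h ≤ Nat.choose (Module.finrank ℂ V + 2 * h - 1) (2 * h) := by
  intro V _ m D h hmem hfree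
  exact choose_le_choose_of_noRelation V D h hmem hfree

/-- **Hilbert-function regime of the formal crux, registered helper form** (sub-goal
`helper_hilbertCount` of item `stmt-ValiantsHypothesis-6534`): the conclusion of item 6536 /
`stub_formalSwallowForcesShortRelation` under `C(s + 60, 60) < C(m + 29, 30)`.
[cite: Narayanan2026, §2 (proof of Thm. 1)] -/
theorem helper_hilbertCount : ∀ (s m : ℕ) (y : Fin s → LaurentSeries ℂ) (d : Fin m → ℕ) (Γ : Fin m → MvPolynomial (Fin s) ℂ), (∀ i, (Γ i).totalDegree ≤ 2) → (∀ i, MvPolynomial.aeval y (Γ i) = HahnSeries.single (d i : ℤ) (1 : ℂ)) → Nat.choose (s + 60) 60 < Nat.choose (m + 29) 30 → ∃ S T : Multiset (Fin m), S ≠ T ∧ Multiset.card S ≤ 30 ∧ Multiset.card T ≤ 30 ∧ (S.map d).sum = (T.map d).sum := by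
  intro s m y d Γ hΓ hy hlt
  exact exists_relation_of_choose_lt y d Γ hΓ hy hlt

end HilbertCount

end Summit.ValiantsHypothesis.ValiantsHypothesis.Theorems
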